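import Summits.SmoothPoincare4.SmoothPoincare4.Theses.EntropyRung
import Summits.SmoothPoincare4.SmoothPoincare4.Theorems.EntropyRungSubcylindricalExistenceLargeScale
import Summits.SmoothPoincare4.SmoothPoincare4.Theorems.EntropyRungSubcylindricalExistenceEntropyTestFunctions
import Literature.Geometry.Riemannian.SchrodingerGroundState
import Literature.Geometry.Riemannian.ShrinkerEntropyProofs
import Literature.Geometry.Lorentzian.ChartLaplacian
import Literature.Geometry.Lorentzian.VolumePositivity
import HarnessLib

/-!
# The ground state of the conformal Laplacian when `R ≥ 0`, `R ≢ 0`, and two bookkeeping lemmas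
# for weighted `𝒲`-clauses (aux for stub `stub_scalarPositiveUpgrade`, line
# `fat-conical-core-avr-logsobolev`, crux `EntropyRung.SubcylindricalExistence`, stmt-SmoothPoincare4-10871)

On a closed connected smooth `4`-manifold of the summit binder with a Riemannian metric `G`
(Levi-Civita connection; `Δ_G = tr_G Hess = G.dalembertian`, `|∇w|²_G = G.gradSq w`, `dV_G` the
Riemannian measure):

* `helper_stub_scalarPositiveUpgrade_groundState` (registered): if `R_G ≥ 0` everywhere and
  `R_G > 0` somewhere, there are a smooth `φ > 0` and `λ > 0` with `R_G φ − 6 Δ_G φ = λ φ`: the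
  ground state of `−Δ_G + R_G/6` (`exists_pos_groundState`, Aubin 1982, Ch. 6, Remark 6.21) has a
  positive eigenvalue, by integrating the equation over `M` (`∫ Δ_G φ dV_G = 0`,
  `integral_dalembertian_eq_zero_of_compactSpace`; `∫ R φ dV_G > 0` since `dV_G` charges open sets).
* `ScalarPositiveUpgradeAux.wClause_weight_one`: the crux's `e^{-f}`-clause at every scale gives the
  `w²`-clause for the weight `φ₀ = 1` in the exact shape of the weight-comparison lemma H3
  (`wClause_weight_comparison`), via `wClause_sq_of_wClause_exp` (Perelman 2002, §3.1).
* `ScalarPositiveUpgradeAux.allScales_of_linearLoss`: a `ψ`-weighted `w²`-clause valid at every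
  scale with a loss `B τ` linear in the scale, together with a pointwise floor `r ≥ a > 0` of the
  curvature weight, holds at EVERY scale with the loss frozen at `τ₀ = 2/a` (small scales directly,
  large scales by `largeScale_propagation`, H11).

Everything is proved; no definition, no named fact.

References: T. Aubin, *Nonlinear Analysis on Manifolds* (1982), Ch. 6, Remark 6.21 [Aubin1982];
G. Perelman, arXiv:math/0211159, §3.1 [Perelman2002Entropy]; J. M. Lee, *Introduction to Riemannian
Manifolds* (2018), Problem 2-23 (c) [Lee2018].
-/

noncomputable section

-- the registered namespace `Summit.SmoothPoincare4.SmoothPoincare4.Theorems` repeats a component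
set_option linter.dupNamespace false

open scoped Manifold ContDiff Topology ENNReal NNReal
open Set Filter MeasureTheory
open Literature.Geometry.Lorentzian Literature.Geometry.Riemannian

namespace Summit.SmoothPoincare4.SmoothPoincare4.Theorems

namespace ScalarPositiveUpgradeAux

variable {M : Type} [TopologicalSpace M] [T2Space M]
  [ChartedSpace (EuclideanSpace ℝ (Fin 4)) M] [IsManifold (𝓡 4) ∞ M] [CompactSpace M]
  [T3Space M] [MeasurableSpace M] [BorelSpace M]
  (G : PseudoRiemannianMetric (𝓡 4) ∞ (EuclideanSpace ℝ (Fin 4)) (TangentSpace (𝓡 4) : M → Type _))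
  [G.HasLeviCivita]

/-! ### The ground state of `−Δ_G + R_G/6` has a positive eigenvalue when `R ≥ 0`, `R ≢ 0` -/

/-- **Positive ground state of the conformal Laplacian.** If `R_G ≥ 0` and `R_G(x₀) > 0`, then
`−Δ_G + R_G/6` has a smooth positive eigenfunction `φ` with eigenvalue `ev > 0`; equivalently
`R_G φ − 6 Δ_G φ = λ φ` with `λ = 6 ev > 0`. Existence: `exists_pos_groundState`; positivity of
`ev`: integrate `−Δ_G φ + (R/6) φ = ev φ` over the closed manifold, `∫ Δ_G φ = 0`,
`∫ R φ > 0`, `∫ φ > 0`. -/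
theorem exists_groundState_pos [ConnectedSpace M] (hG : G.IsRiemannian)
    (hR0 : ∀ x, 0 ≤ G.scalarCurvature x) (hRpos : ∃ x, 0 < G.scalarCurvature x) :
    ∃ φ : M → ℝ, ∃ lam : ℝ, ContMDiff (𝓡 4) 𝓘(ℝ, ℝ) ∞ φ ∧ (∀ x, 0 < φ x) ∧ 0 < lam ∧
      ∀ x, G.scalarCurvature x * φ x - 6 * G.dalembertian φ x = lam * φ x := by
  obtain ⟨x₀, hx₀⟩ := hRpos
  haveI : Nonempty M := ⟨x₀⟩
  have hV : ContMDiff (𝓡 4) 𝓘(ℝ, ℝ) ∞ (fun x ↦ G.scalarCurvature x / 6) :=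
    G.contMDiff_scalarCurvature.div_const 6
  obtain ⟨φ, ev, hφ, hφpos, hpde, -⟩ := exists_pos_groundState G (by norm_num) hG hV
  refine ⟨φ, 6 * ev, hφ, hφpos, ?_, fun x ↦ by linear_combination (6 : ℝ) * hpde x⟩
  -- `ev > 0`: integrate the equation over `M`
  set μ : Measure M := riemannianMeasure (G.toContMDiffRiemannianMetric hG) with hμ
  haveI : IsFiniteMeasure μ := isFiniteMeasure_riemannianMeasure _
  haveI : μ.IsOpenPosMeasure := isOpenPosMeasure_riemannianMeasure _
  have hφc : Continuous φ := hφ.continuous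
  have hRc : Continuous G.scalarCurvature := G.contMDiff_scalarCurvature.continuous
  have hφ2 : ContMDiff (𝓡 4) 𝓘(ℝ, ℝ) 2 φ := hφ.of_le (WithTop.coe_le_coe.mpr le_top)
  have hint : ∀ {F : M → ℝ}, Continuous F → Integrable F μ := fun hF ↦
    EntropyLocalisation.integrable_of_continuous G hG hF
  have hΔ0 : ∫ x, G.dalembertian φ x ∂μ = 0 := by
    have h := CarrilloNi2009_shrinkerLSI.integral_dalembertian_eq_zero_of_compactSpace hG hφ2
    rwa [PseudoRiemannianMetric.riemVolume_eq hG] at h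
  have iΔ : Integrable (fun x ↦ -G.dalembertian φ x) μ := (hint (continuous_dalembertian G hφ2)).neg
  have iRφ : Integrable (fun x ↦ G.scalarCurvature x / 6 * φ x) μ := hint ((hRc.div_const 6).mul hφc)
  have hI : ∫ x, (-G.dalembertian φ x + G.scalarCurvature x / 6 * φ x) ∂μ = ∫ x, ev * φ x ∂μ :=
    integral_congr_ae (ae_of_all _ fun x ↦ hpde x)
  rw [integral_add iΔ iRφ, integral_neg, hΔ0, neg_zero, zero_add, integral_const_mul] at hI
  have hφI : 0 < ∫ x, φ x ∂μ := by
    rw [integral_pos_iff_support_of_nonneg (fun x ↦ (hφpos x).le) (hint hφc)]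
    have hsupp : Function.support φ = univ := by
      ext x; simp [(hφpos x).ne']
    rw [hsupp]
    exact isOpen_univ.measure_pos μ univ_nonempty
  have hRφ : 0 < ∫ x, G.scalarCurvature x / 6 * φ x ∂μ := by
    rw [integral_pos_iff_support_of_nonneg (fun x ↦ mul_nonneg (div_nonneg (hR0 x) (by norm_num))
      (hφpos x).le) iRφ]
    refine (((hRc.div_const 6).mul hφc).isOpen_support).measure_pos μ ⟨x₀, ?_⟩
    rw [Function.mem_support]
    exact (mul_pos (div_pos hx₀ (by norm_num)) (hφpos x₀)).ne'
  rw [hI] at hRφ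
  have hev : 0 < ev := by
    by_contra h
    have : ev * ∫ x, φ x ∂μ ≤ 0 := mul_nonpos_of_nonpos_of_nonneg (not_lt.mp h) hφI.le
    linarith
  positivity

/-! ### The weight-one `w²`-clause in the shape of the weight-comparison lemma -/

omit [T2Space M] in
/-- **The `e^{-f}`-clause at every scale gives the `w²`-clause for the weight `φ₀ = 1`** (all
scales, test functions with zeros allowed), written exactly as hypothesis of
`wClause_weight_comparison` with `φ₀ = 1`, `r₀ = R_G`. -/
theorem wClause_weight_one [SecondCountableTopology M] (hG : G.IsRiemannian) {L : ℝ}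
    (hclause : ∀ τ : ℝ, 0 < τ → ∀ f : M → ℝ, ContMDiff (𝓡 4) 𝓘(ℝ, ℝ) ∞ f →
      ∫ x, (4 * Real.pi * τ) ^ (-(4 : ℝ) / 2) * Real.exp (-f x)
          ∂(riemannianMeasure (G.toContMDiffRiemannianMetric hG)) = 1 →
        L ≤ ∫ x, (τ * (G.scalarCurvature x + G.gradSq f x) + f x - 4) *
          ((4 * Real.pi * τ) ^ (-(4 : ℝ) / 2) * Real.exp (-f x))
          ∂(riemannianMeasure (G.toContMDiffRiemannianMetric hG))) :
    ∀ τ' : ℝ, 0 < τ' → ∀ v : M → ℝ, ContMDiff (𝓡 4) 𝓘(ℝ, ℝ) ∞ v → tsupport v ⊆ univ →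
      ∫ x, (4 * Real.pi * τ') ^ (-(4 : ℝ) / 2) * (v x) ^ 2 * (1 : ℝ) ^ 4
          ∂(riemannianMeasure (G.toContMDiffRiemannianMetric hG)) = 1 →
        L ≤ ∫ x, (τ' * (G.scalarCurvature x * (v x) ^ 2 + 4 * ((1 : ℝ)⁻¹ ^ 2 * G.gradSq v x))
            - (v x) ^ 2 * Real.log ((v x) ^ 2) - 4 * (v x) ^ 2)
            * ((4 * Real.pi * τ') ^ (-(4 : ℝ) / 2) * (1 : ℝ) ^ 4)
          ∂(riemannianMeasure (G.toContMDiffRiemannianMetric hG)) := by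
  intro τ hτ v hv _ hnorm
  simp only [one_pow, mul_one, inv_one, one_mul] at hnorm ⊢
  exact wClause_sq_of_wClause_exp M G hG L τ hτ (hclause τ hτ) v hv hnorm

/-! ### A clause with a loss linear in the scale holds at all scales -/

omit [T2Space M] in
/-- **Freezing a linear-in-`τ` loss at `τ₀ = 2/a`.** If the `ψ`-weighted `w²`-clause holds at every
scale `τ` at level `L₁ − B τ` (`B ≥ 0`) and the curvature weight has a floor `r ≥ a > 0`, then it
holds at every scale at level `L₁ − B (2/a)`: for `τ ≤ 2/a` directly, for `τ ≥ 2/a` by H11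
`largeScale_propagation` (the quadratic part is `≥ a ∫ c w² ψ⁴ = a`). -/
theorem allScales_of_linearLoss [SecondCountableTopology M] (hG : G.IsRiemannian) {ψ r : M → ℝ}
    (hψ : ContMDiff (𝓡 4) 𝓘(ℝ, ℝ) ∞ ψ) (hψpos : ∀ x, 0 < ψ x) (hr : Continuous r) {a B L₁ : ℝ}
    (ha : 0 < a) (har : ∀ x, a ≤ r x) (hB : 0 ≤ B)
    (h : ∀ τ : ℝ, 0 < τ → ∀ w : M → ℝ, ContMDiff (𝓡 4) 𝓘(ℝ, ℝ) ∞ w →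
      ∫ x, (4 * Real.pi * τ) ^ (-(4 : ℝ) / 2) * (w x) ^ 2 * (ψ x) ^ 4
          ∂(riemannianMeasure (G.toContMDiffRiemannianMetric hG)) = 1 →
        L₁ - B * τ ≤ ∫ x, (τ * (r x * (w x) ^ 2 + 4 * ((ψ x)⁻¹ ^ 2 * G.gradSq w x))
            - (w x) ^ 2 * Real.log ((w x) ^ 2) - 4 * (w x) ^ 2)
            * ((4 * Real.pi * τ) ^ (-(4 : ℝ) / 2) * (ψ x) ^ 4)
          ∂(riemannianMeasure (G.toContMDiffRiemannianMetric hG))) :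
    ∀ τ : ℝ, 0 < τ → ∀ w : M → ℝ, ContMDiff (𝓡 4) 𝓘(ℝ, ℝ) ∞ w →
      ∫ x, (4 * Real.pi * τ) ^ (-(4 : ℝ) / 2) * (w x) ^ 2 * (ψ x) ^ 4
          ∂(riemannianMeasure (G.toContMDiffRiemannianMetric hG)) = 1 →
        L₁ - B * (2 / a) ≤ ∫ x, (τ * (r x * (w x) ^ 2 + 4 * ((ψ x)⁻¹ ^ 2 * G.gradSq w x))
            - (w x) ^ 2 * Real.log ((w x) ^ 2) - 4 * (w x) ^ 2)
            * ((4 * Real.pi * τ) ^ (-(4 : ℝ) / 2) * (ψ x) ^ 4)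
          ∂(riemannianMeasure (G.toContMDiffRiemannianMetric hG)) := by
  set μ : Measure M := riemannianMeasure (G.toContMDiffRiemannianMetric hG) with hμ
  -- the quadratic part is at least `a`
  have hquad : ∀ τ : ℝ, 0 < τ → ∀ w : M → ℝ, ContMDiff (𝓡 4) 𝓘(ℝ, ℝ) ∞ w →
      ∫ x, (4 * Real.pi * τ) ^ (-(4 : ℝ) / 2) * (w x) ^ 2 * (ψ x) ^ 4 ∂μ = 1 →
        a ≤ ∫ x, (r x * (w x) ^ 2 + 4 * ((ψ x)⁻¹ ^ 2 * G.gradSq w x))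
            * ((4 * Real.pi * τ) ^ (-(4 : ℝ) / 2) * (ψ x) ^ 4) ∂μ := by
    intro τ hτ w hw hnorm
    set c : ℝ := (4 * Real.pi * τ) ^ (-(4 : ℝ) / 2) with hc
    have hc0 : 0 < c := Real.rpow_pos_of_pos (by positivity) _
    have iQ : Integrable (fun x ↦ (r x * (w x) ^ 2 + 4 * ((ψ x)⁻¹ ^ 2 * G.gradSq w x))
        * (c * (ψ x) ^ 4)) μ :=
      EntropyLocalisation.integrable_of_continuous G hG (LargeScale.continuous_quadDensity G hψ hψpos hr hw c)
    have iN : Integrable (fun x ↦ c * (w x) ^ 2 * (ψ x) ^ 4) μ :=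
      EntropyLocalisation.integrable_of_continuous G hG
        ((continuous_const.mul (hw.continuous.pow 2)).mul (hψ.continuous.pow 4))
    calc a = a * ∫ x, c * (w x) ^ 2 * (ψ x) ^ 4 ∂μ := by rw [hnorm, mul_one]
      _ = ∫ x, a * (c * (w x) ^ 2 * (ψ x) ^ 4) ∂μ := (integral_const_mul _ _).symm
      _ ≤ _ := by
        refine integral_mono (iN.const_mul a) iQ fun x ↦ ?_
        have hGw : 0 ≤ G.gradSq w x := G.gradSq_nonneg hG w x
        have h1 : 0 ≤ (r x - a) * ((w x) ^ 2 * (c * (ψ x) ^ 4)) :=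
          mul_nonneg (sub_nonneg.2 (har x)) (by positivity)
        have h2 : 0 ≤ 4 * ((ψ x)⁻¹ ^ 2 * G.gradSq w x) * (c * (ψ x) ^ 4) := by positivity
        have e : (r x * (w x) ^ 2 + 4 * ((ψ x)⁻¹ ^ 2 * G.gradSq w x)) * (c * (ψ x) ^ 4)
            - a * (c * (w x) ^ 2 * (ψ x) ^ 4) =
            (r x - a) * ((w x) ^ 2 * (c * (ψ x) ^ 4))
              + 4 * ((ψ x)⁻¹ ^ 2 * G.gradSq w x) * (c * (ψ x) ^ 4) := by ring
        dsimp only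
        linarith
  intro τ hτ w hw hnorm
  by_cases hcase : τ ≤ 2 / a
  · have h1 := h τ hτ w hw hnorm
    have h2 : B * τ ≤ B * (2 / a) := mul_le_mul_of_nonneg_left hcase hB
    linarith
  · have hτ₀ : 0 < 2 / a := by positivity
    have haτ : 2 ≤ a * (2 / a) := by
      rw [mul_div_cancel₀ _ ha.ne']
    exact largeScale_propagation M G hG ψ r hψ hψpos hr (L₁ - B * (2 / a)) a (2 / a) hτ₀ ha haτ
      (fun w hw hn ↦ h (2 / a) hτ₀ w hw hn) hquad τ (le_of_not_ge hcase) w hw hnorm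

end ScalarPositiveUpgradeAux

/-- **Registered helper `helper_stub_scalarPositiveUpgrade_groundState`** (aux for stub
`stub_scalarPositiveUpgrade`): on a closed connected Riemannian `4`-manifold with `R_G ≥ 0`,
`R_G ≢ 0`, there are a smooth `φ > 0` and `λ > 0` with `R_G φ − 6 Δ_G φ = λ φ` (positive ground
state of the conformal Laplacian). [cite: Aubin1982, Ch. 6, Remark 6.21] -/
theorem helper_stub_scalarPositiveUpgrade_groundState :
    ∀ (M : Type) [TopologicalSpace M] [T2Space M] [SecondCountableTopology M]
    [ChartedSpace (EuclideanSpace ℝ (Fin 4)) M] [IsManifold (𝓡 4) ∞ M] [CompactSpace M]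
    [ConnectedSpace M] [T3Space M] [MeasurableSpace M] [BorelSpace M]
    (G : PseudoRiemannianMetric (𝓡 4) ∞ (EuclideanSpace ℝ (Fin 4)) (TangentSpace (𝓡 4) : M → Type _))
    [G.HasLeviCivita] (hG : G.IsRiemannian),
    (∀ x : M, 0 ≤ G.scalarCurvature x) → (∃ x : M, 0 < G.scalarCurvature x) →
    ∃ φ : M → ℝ, ∃ lam : ℝ, ContMDiff (𝓡 4) 𝓘(ℝ, ℝ) ∞ φ ∧ (∀ x : M, 0 < φ x) ∧ 0 < lam ∧
      ∀ x : M, G.scalarCurvature x * φ x - 6 * G.dalembertian φ x = lam * φ x := by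
  intro M _ _ _ _ _ _ _ _ _ _ G _ hG hR0 hRpos
  exact ScalarPositiveUpgradeAux.exists_groundState_pos G hG hR0 hRpos

end Summit.SmoothPoincare4.SmoothPoincare4.Theorems

end
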